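import Mathlib.NumberTheory.ArithmeticFunction.Liouville
import Mathlib.NumberTheory.ArithmeticFunction.Moebius
import Mathlib.Analysis.Asymptotics.Defs
import Literature.NumberTheory.Sieve.PretentiousDistance
import Literature.NumberTheory.Sieve.ParityWave0
import HarnessLib

-- provenance: harness21/H21/H21/Statements/Parity/MultiplicativeCorrelations.lean @ 04f08e6 (interim HEAD d8f2665); M5 mechanical rewrite
/-!
# Correlations of multiplicative functions: Elliott's conjecture (family Parity, trunk AntSieve)

This file states

* **parity.S24** `Literature.NumberTheory.LFunctions.ElliottConjectureMRT`: the Elliott conjecture on correlations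
  `∑_{n ≤ x} g₁(n + h₁) ⋯ g_k(n + h_k) = o(x)` of `1`-bounded multiplicative functions, in the
  corrected form of Matomäki–Radziwiłł–Tao (2015), Conjecture 1.5: the shifts are distinct and
  some `g_j` is non-pretentious in the sense that for every fixed Dirichlet character `χ`,
  `inf_{|t| ≤ x} 𝔻(g_j, χ(n) n^{it}; x) → ∞` (`Literature.NumberTheory.Sieve.IsNonpretentious`);
* `Literature.NumberTheory.LFunctions.tao_log_averaged_elliott_two`: Tao's logarithmically averaged, non-asymptotic two-point
  case (Tao 2016, Theorem 1.3);
* `Literature.NumberTheory.LFunctions.tao_log_chowla_two`: the two-point logarithmically averaged Chowla conjecture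
  `∑_{n ≤ x} λ(n) λ(n + h) / n = o(log x)` (Tao 2016, Theorem 1.2), deduced here from the accepted
  Wave 0 statement `Literature.NumberTheory.Sieve.tao_log_chowla_liouville` (parity.S21).

## Sources
* P. D. T. A. Elliott, *On the correlation of multiplicative functions*, Notas Soc. Mat. Chile 11
  (1992); *On the correlation of multiplicative and the sum of additive arithmetic functions*,
  Mem. Amer. Math. Soc. 538 (1994).
* K. Matomäki, M. Radziwiłł, T. Tao, *An averaged form of Chowla's conjecture*, Algebra & Number
  Theory 9 (2015), Conjecture 1.5 (and the counterexample to Elliott's original formulation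
  preceding it).
* T. Tao, *The logarithmically averaged Chowla and Elliott conjectures for two-point
  correlations*, Forum Math. Pi 4 (2016), e8, Theorems 1.2 and 1.3.
* O. Klurman, A. P. Mangerel, J. Teräväinen, *On Elliott's conjecture and applications*,
  arXiv:2304.05344 (2023), §1 (status of the corrected conjecture: open, "believed to be true";
  Theorem 1.2: the two-point case at almost all scales).

## Mathlib / H21
Multiplicative functions are Mathlib's `ArithmeticFunction ℂ` with
`ArithmeticFunction.IsMultiplicative` (the convention of the accepted
`Literature.NumberTheory.Sieve.matomaki_radziwill`; no local multiplicativity predicate). The pretentious-distance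
notions `Literature.NumberTheory.Sieve.pretentiousDistSq`, `Literature.NumberTheory.Sieve.twistedChar`, `Literature.NumberTheory.Sieve.IsNonpretentious` come from
`Literature.Prelude.AntSieve.PretentiousDistance` and are applied to arithmetic functions through the
coercion `ArithmeticFunction ℂ → ℕ → ℂ`. Little-o is Mathlib's `Asymptotics.IsLittleO` along
`atTop` on `ℕ`. Mathlib (searched `Elliott`, `Chowla`, `pretentious`, `correlation`) has none of
these statements.

## Design choices
* In `ElliottConjectureMRT` the shifts are natural numbers `h : Fin k → ℕ`, required to be
  pairwise distinct (`Function.Injective h`); `k ≥ 1` is forced by the hypothesis `∃ j, …`.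
* `tao_log_averaged_elliott_two` transcribes Tao's Theorem 1.3 in its `∀ ε, ∃ A₀, ∀ A ≥ A₀, …`
  form. The paper's hypothesis
  `inf_{|t| ≤ A x} inf_{q ≤ A} inf_{χ (q)} 𝔻(g₁, χ(n) n^{it}; x)² ≥ A`
  has a `t`-range `|t| ≤ A x` differing from the prime range `p ≤ x`, so it is not literally
  `Literature.nonpretentiousness g₁ x A ≥ A` (whose `t`-range is `|t| ≤ x`); we therefore spell it out
  pointwise with `Literature.NumberTheory.Sieve.pretentiousDistSq` and `Literature.NumberTheory.Sieve.twistedChar` (a pointwise lower bound over the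
  index set, equivalent to the bound on the infimum and free of `iInf` junk values). The shifts
  `b₁, b₂` are natural numbers (the paper allows integers), as in Wave 0's parity.S21, and the
  sum over `x/ω < n ≤ x` is `Finset.Ioc ⌊x/ω⌋₊ ⌊x⌋₊`.
-/

open Filter Asymptotics Finset

namespace Literature.NumberTheory.LFunctions

/-- **parity.S24** (Elliott's conjecture in the corrected form of Matomäki–Radziwiłł–Tao:
Algebra & Number Theory 9 (2015), Conjecture 1.5 with the hypothesis (1.6) `M(g_{j₀}; ∞, ∞) = ∞`
replaced by (1.8) `M(g_{j₀}; X, Q) → ∞` as `X → ∞` for each fixed `Q`; after Elliott, Notas Soc.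
Mat. Chile 11 (1992) and Mem. Amer. Math. Soc. 538 (1994)). Let `g₁, …, g_k : ℕ → ℂ` be
multiplicative with `|g_j| ≤ 1`, let `h₁, …, h_k` be distinct shifts, and suppose that some `g_j`
is non-pretentious: for every Dirichlet character `χ`,
`inf_{|t| ≤ x} 𝔻(g_j, n ↦ χ(n) n^{it}; x) → ∞` as `x → ∞` (`Sieve.IsNonpretentious`; since there
are finitely many characters of modulus `≤ Q`, this is exactly (1.8)). Then
`∑_{n ≤ x} g₁(n + h₁) ⋯ g_k(n + h_k) = o(x)`. This is the case `a_j = 1`, `b_j = h_j` of the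
printed conjecture `∑_{n ≤ X} ∏ⱼ g_j(a_j n + b_j) = o(X)` (pairwise linear independence of
`(1, h_i), (1, h_j)` in `ℚ²` is `h_i ≠ h_j`).
STATUS: OPEN. It implies Chowla's conjecture `Literature.NumberTheory.Sieve.ChowlaConjecture` and
its Möbius form, open for every `k ≥ 2` (MRT, §1, after Conjecture 1.5: "so Elliott's conjecture
implies Chowla's conjecture"; proved in the tree, unconditionally in `λ`, `μ`:
`chowlaConjecture_of_elliottConjectureMRT`, `moebiusChowlaConjecture_of_elliottConjectureMRT` in
`MultiplicativeCorrelationsProofs`), so no discharge `ElliottConjectureMRT_holds` exists;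
Klurman–Mangerel–Teräväinen (2023, §1) call the corrected form "believed to be true" and prove
the two-point case at almost all scales (their Theorem 1.2). The ORIGINAL form (hypothesis (1.6))
is false (MRT, Theorem B.1; tree: `Literature.Barriers.Parity.ElliottConjectureOriginal_false`).
The logarithmically averaged case `k = 2` is the theorem `tao_log_averaged_elliott_two`.
[cite: MatomakiRadziwillTao2015, Conjecture 1.5 with hypothesis (1.8), §1 (arXiv p. 4)]
[cite: Elliott1992Correlations] [cite: Elliott1994]
[cite: KlurmanMangerelTeravainen2023, §1 and Theorem 1.2 (status)] -/
def ElliottConjectureMRT : Prop :=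
  ∀ (k : ℕ) (g : Fin k → ArithmeticFunction ℂ) (h : Fin k → ℕ),
    (∀ j, (g j).IsMultiplicative) → (∀ j n, ‖g j n‖ ≤ 1) → Function.Injective h →
    (∃ j, Sieve.IsNonpretentious (g j)) →
    (fun x : ℕ ↦ ∑ n ∈ Icc 1 x, ∏ j, g j (n + h j)) =o[atTop] fun x : ℕ ↦ (x : ℂ)

/-- **parity.S24** (logarithmically averaged non-asymptotic Elliott conjecture for two-point
correlations; Tao, Forum Math. Pi 4 (2016), e8, Theorem 1.3). Let `a₁, a₂ ≥ 1` and `b₁, b₂` with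
`a₁ b₂ ≠ a₂ b₁`, and let `ε > 0`. If `A` is sufficiently large (depending on
`ε, a₁, a₂, b₁, b₂`), then for all `x ≥ ω ≥ A` and all `1`-bounded multiplicative
`g₁, g₂ : ℕ → ℂ` such that
`𝔻(g₁, n ↦ χ(n) n^{it}; x)² ≥ A` for all `|t| ≤ A x`, all moduli `1 ≤ q ≤ A` and all Dirichlet
characters `χ` mod `q`, one has
`|∑_{x/ω < n ≤ x} g₁(a₁ n + b₁) g₂(a₂ n + b₂) / n| ≤ ε log ω`. [cite: TaoFMP2016, Theorem 1.3] -/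
def tao_log_averaged_elliott_two : Prop :=
  ∀ (a₁ a₂ b₁ b₂ : ℕ) (ha₁ : 1 ≤ a₁) (ha₂ : 1 ≤ a₂) (hab : a₁ * b₂ ≠ a₂ * b₁) (ε : ℝ) (hε : 0 < ε),
    ∃ A₀ : ℝ, ∀ A : ℝ, A₀ ≤ A → ∀ x ω : ℝ, A ≤ ω → ω ≤ x →
      ∀ g₁ g₂ : ArithmeticFunction ℂ, g₁.IsMultiplicative → g₂.IsMultiplicative →
        (∀ n, ‖g₁ n‖ ≤ 1) → (∀ n, ‖g₂ n‖ ≤ 1) →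
        (∀ (q : ℕ) (χ : DirichletCharacter ℂ q) (t : ℝ), 1 ≤ q → (q : ℝ) ≤ A → |t| ≤ A * x →
          A ≤ Sieve.pretentiousDistSq g₁ (Sieve.twistedChar χ t) x) →
        ‖∑ n ∈ Ioc ⌊x / ω⌋₊ ⌊x⌋₊, g₁ (a₁ * n + b₁) * g₂ (a₂ * n + b₂) / (n : ℂ)‖
          ≤ ε * Real.log ω

/-- **parity.S24** (logarithmically averaged two-point Chowla conjecture; Tao, Forum Math. Pi 4
(2016), e8, Theorem 1.2). For every shift `h ≠ 0`,
`∑_{n ≤ x} λ(n) λ(n + h) / n = o(log x)`. Deduced from the Wave 0 statement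
`Literature.NumberTheory.Sieve.tao_log_chowla_liouville` (parity.S21) with `a₁ = a₂ = 1`, `b₁ = 0`, `b₂ = h`. [folklore] -/
def tao_log_chowla_two : Prop :=
  ∀ (h : ℕ) (hh : h ≠ 0),
    (fun x : ℕ ↦ ∑ n ∈ Icc 1 x,
        (ArithmeticFunction.liouville n * ArithmeticFunction.liouville (n + h) : ℝ) / n)
      =o[atTop] fun x : ℕ ↦ Real.log x

/- interim proof relied on results that are now named facts (D-0014); demoted to a fact by the M5 import, proof preserved:
:= by
  simpa using Parity.tao_log_chowla_liouville 1 1 0 h le_rfl le_rfl (by simpa using hh)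
-/

end Literature.NumberTheory.LFunctions
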